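import Summits.QuantumFields.GaugeBoot.DiagonalRPTorusRestClustering
import HarnessLib

/-!
# Far pairs: joining sets across a torus distance are long; uniform decay of far rest correlations
(gauge-boot, L3 `d = 3` uniform window, brick 4)

HONEST FRAMING (cell `pub-gaugeboot`, page 1 of every file): the venture produces certified bounds
on lattice expectations at stated coupling, gauge group, dimension and torus size; NOT a mass gap,
NOT a continuum limit, NOT a string tension; NOT Yang–Mills-summit-bearing (barriers
`FixedCouplingUltralocality`, `PerturbativeInvisibility`). This module is torus geometry plus one
application of `DiagonalRPTorusRestClustering.abs_restTrunc_le`; it discharges nothing by itself.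

## Content (torus `(ℤ/L)^d`)

* `cyc z = |z|` on the cycle `ℤ/L` (`ZMod.valMinAbs`, i.e. `min (z.val) (L - z.val)`): `cyc 0 = 0`,
  `cyc (-z) = cyc z`, `cyc (a + b) ≤ cyc a + cyc b`, `cyc 1 ≤ 1`; the TORUS SUP-DISTANCE
  `tsd x y = max_k cyc (y_k - x_k)` of sites: triangle inequality, symmetry, `tsd x (x + e_k) ≤ 1`.
* Plaquettes sharing a link have base points at `tsd ≤ 1` (`tsd_le_one_of_padj`), so
  `q ↦ tsd y (base q)` is a LEVEL FUNCTION for `DiagRPUnif.le_card_of_tjoins`; a plaquette touching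
  a link based within `r` of `y` has level `≤ r + 1` (`tsd_le_of_touch`).
* ★ **`le_card_of_tjoins_far`** — if `E₁` consists of links based within `r₁` of `y₁` and `E₂` of
  links based within `r₂` of `y₂`, every set of plaquettes joining `E₁` to `E₂` has at least
  `tsd y₁ y₂ - (r₁ + r₂ + 2)` elements.
* ★★ **`abs_restTrunc_le_of_far`** — hence, for bounded measurable `f`, `g` reading such (disjoint)
  link sets and `0 ≤ β ≤ r < betaOne d ρ`, for EVERY set `V` of plaquettes switched on:
  `|⟨fg⟩_V - ⟨f⟩_V⟨g⟩_V| ≤ 2 C_f C_g κ^{(#E₁+#E₂) 2^d d²} (β/r)^{tsd y₁ y₂ - (r₁ + r₂ + 2)}` — the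
  decay of far rest correlations, UNIFORM in `L` and `V`.
* `tsd_siteDiagSwap` — the distance from a site to its diagonal mirror image is `cyc (y_i - y_j)`,
  i.e. `L/2 - 1` on the inner top layer `δ = L/2 - 1` of the lane's witnesses: the DIAGONAL pairs of
  `DiagonalRPTorusRestTruncated.trickForm_sub_eq` are far, with exponent `≍ L/2`.

Elementary; no named fact. Architecture: `HOME/pub-gaugeboot-lean3/gen46/D3-UNIFORM-PLAN.md`.
-/

open MeasureTheory Finset Function

namespace Summit.QuantumFields.GaugeBoot

open Literature.MathematicalPhysics.QuantumFieldTheory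

noncomputable section

namespace DiagRPUnif

open DiagRPTube

/-! ## The cycle distance and the torus sup-distance -/

section Geometry

variable {d L : ℕ}

/-- The distance from `0` on the cycle `ℤ/L`: `min (z.val) (L - z.val)`. -/
def cyc (z : ZMod L) : ℕ := z.valMinAbs.natAbs

/-- `cyc 0 = 0`. -/
@[simp] theorem cyc_zero : cyc (0 : ZMod L) = 0 := by simp [cyc, ZMod.valMinAbs_zero]

/-- `cyc (-z) = cyc z`. -/
@[simp] theorem cyc_neg (z : ZMod L) : cyc (-z) = cyc z := ZMod.natAbs_valMinAbs_neg z

/-- Subadditivity: `cyc (a + b) ≤ cyc a + cyc b`. -/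
theorem cyc_add_le (a b : ZMod L) : cyc (a + b) ≤ cyc a + cyc b :=
  (ZMod.natAbs_valMinAbs_add_le a b).trans (Int.natAbs_add_le _ _)

/-- `cyc (a - b) ≤ cyc a + cyc b`. -/
theorem cyc_sub_le (a b : ZMod L) : cyc (a - b) ≤ cyc a + cyc b := by
  rw [sub_eq_add_neg]
  exact (cyc_add_le a (-b)).trans (by rw [cyc_neg])

/-- `cyc z ≤ z.val`. -/
theorem cyc_le_val [NeZero L] (z : ZMod L) : cyc z ≤ z.val := by
  rw [cyc, ZMod.valMinAbs_natAbs_eq_min]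
  exact min_le_left _ _

/-- `cyc 1 ≤ 1`. -/
theorem cyc_one_le [NeZero L] : cyc (1 : ZMod L) ≤ 1 :=
  (cyc_le_val 1).trans (by rw [ZMod.val_one_eq_one_mod]; exact Nat.mod_le 1 L)

/-- `cyc (a - b) ≤ 1` for `a, b ∈ {0, 1}`. -/
theorem cyc_sub_le_one_of_mem [NeZero L] {a b : ZMod L} (ha : a = 0 ∨ a = 1) (hb : b = 0 ∨ b = 1) :
    cyc (a - b) ≤ 1 := by
  rcases ha with rfl | rfl <;> rcases hb with rfl | rfl
  · simp
  · rw [zero_sub, cyc_neg]; exact cyc_one_le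
  · rw [sub_zero]; exact cyc_one_le
  · simp

/-- The TORUS SUP-DISTANCE of two sites: `max_k cyc (y_k - x_k)`. -/
def tsd (x y : Site d L) : ℕ := univ.sup fun k => cyc (y k - x k)

/-- Coordinatewise bound. -/
theorem cyc_apply_le_tsd (x y : Site d L) (k : Fin d) : cyc (y k - x k) ≤ tsd x y :=
  le_sup (f := fun k => cyc (y k - x k)) (mem_univ k)

/-- `tsd` is bounded by a coordinatewise bound. -/
theorem tsd_le_of_forall {x y : Site d L} {n : ℕ} (h : ∀ k, cyc (y k - x k) ≤ n) : tsd x y ≤ n :=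
  Finset.sup_le fun k _ => h k

/-- `tsd x x = 0`. -/
@[simp] theorem tsd_self (x : Site d L) : tsd x x = 0 :=
  Nat.le_zero.1 (tsd_le_of_forall fun k => by simp)

/-- Symmetry. -/
theorem tsd_comm (x y : Site d L) : tsd x y = tsd y x := by
  unfold tsd
  congr 1
  funext k
  rw [← cyc_neg, neg_sub]

/-- **Triangle inequality.** -/
theorem tsd_triangle (x y z : Site d L) : tsd x z ≤ tsd x y + tsd y z :=
  tsd_le_of_forall fun k =>
    calc cyc (z k - x k) = cyc ((z k - y k) + (y k - x k)) := by rw [sub_add_sub_cancel]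
      _ ≤ cyc (z k - y k) + cyc (y k - x k) := cyc_add_le _ _
      _ ≤ tsd y z + tsd x y := add_le_add (cyc_apply_le_tsd y z k) (cyc_apply_le_tsd x y k)
      _ = tsd x y + tsd y z := add_comm _ _

/-- A unit vector has coordinates in `{0, 1}`. -/
theorem single_apply_mem (m k : Fin d) :
    (Pi.single m (1 : ZMod L) : Site d L) k = 0 ∨ (Pi.single m (1 : ZMod L) : Site d L) k = 1 := by
  by_cases hk : k = m
  · subst hk; exact Or.inr (Pi.single_eq_same _ _)
  · exact Or.inl (Pi.single_eq_of_ne hk _)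

/-- The base points of the four links of a plaquette are the base point plus `0` or a unit
vector. -/
theorem link_fst_eq (q : Plaquette d L) (a : Fin 4) :
    ∃ u : Site d L, (link q a).1 = q.1 + u ∧ ∀ k, u k = 0 ∨ u k = 1 := by
  fin_cases a
  · exact ⟨0, by simp [link], fun k => Or.inl rfl⟩
  · exact ⟨Pi.single q.2.1.1 1, rfl, single_apply_mem _⟩
  · exact ⟨Pi.single q.2.1.2 1, rfl, single_apply_mem _⟩
  · exact ⟨0, by simp [link], fun k => Or.inl rfl⟩

/-- A link of a plaquette is based within torus distance `1` of the base point. -/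
theorem tsd_link_fst_le [NeZero L] (q : Plaquette d L) (a : Fin 4) : tsd (link q a).1 q.1 ≤ 1 := by
  obtain ⟨u, hu, hu01⟩ := link_fst_eq q a
  rw [hu]
  refine tsd_le_of_forall fun k => ?_
  rw [show q.1 k - (q.1 + u) k = 0 - u k by simp [Pi.add_apply]]
  exact cyc_sub_le_one_of_mem (Or.inl rfl) (hu01 k)

/-- **Plaquettes sharing a link have base points at torus distance `≤ 1`.** -/
theorem tsd_le_one_of_padj [NeZero L] {p q : Plaquette d L} (h : padj p q) : tsd p.1 q.1 ≤ 1 := by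
  obtain ⟨a, b, hab⟩ := h
  obtain ⟨u, hu, hu01⟩ := link_fst_eq p a
  obtain ⟨u', hu', hu01'⟩ := link_fst_eq q b
  have hbase : p.1 + u = q.1 + u' := by rw [← hu, ← hu', hab]
  refine tsd_le_of_forall fun k => ?_
  have hk : q.1 k - p.1 k = u k - u' k := by
    have := congr_fun hbase k
    simp only [Pi.add_apply] at this
    linear_combination -this
  rw [hk]
  exact cyc_sub_le_one_of_mem (hu01 k) (hu01' k)

/-- **The torus distance from a fixed site is a level function**: `1`-Lipschitz along `padj`. -/
theorem tsd_le_tsd_add_one_of_padj [NeZero L] (y : Site d L) {p q : Plaquette d L} (h : padj p q) :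
    tsd y q.1 ≤ tsd y p.1 + 1 :=
  (tsd_triangle y p.1 q.1).trans (Nat.add_le_add_left (tsd_le_one_of_padj h) _)

/-- A plaquette touching a link based within `r` of `y` is based within `r + 1` of `y`. -/
theorem tsd_le_of_touch [NeZero L] {y : Site d L} {r : ℕ} {E : Finset (Edge d L)}
    (hE : ∀ e ∈ E, tsd y e.1 ≤ r) {q : Plaquette d L} (hq : Touch E q) : tsd y q.1 ≤ r + 1 := by
  obtain ⟨a, ha⟩ := hq
  exact (tsd_triangle y (link q a).1 q.1).trans (add_le_add (hE _ ha) (tsd_link_fst_le q a))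

/-- A plaquette touching a link based within `r` of `y₂` is based at distance
`≥ tsd y₁ y₂ - (r + 1)` from `y₁`. -/
theorem le_tsd_of_touch [NeZero L] {y₁ y₂ : Site d L} {r : ℕ} {E : Finset (Edge d L)}
    (hE : ∀ e ∈ E, tsd y₂ e.1 ≤ r) {q : Plaquette d L} (hq : Touch E q) :
    tsd y₁ y₂ - (r + 1) ≤ tsd y₁ q.1 := by
  have h1 : tsd y₂ q.1 ≤ r + 1 := tsd_le_of_touch hE hq
  have h2 := tsd_triangle y₁ q.1 y₂
  rw [tsd_comm q.1 y₂] at h2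
  omega

/-- ★ **Far supports force long joining sets.** If the links of `E₁` are based within `r₁` of `y₁`
and those of `E₂` within `r₂` of `y₂`, every set of plaquettes joining `E₁` to `E₂` has at least
`tsd y₁ y₂ - (r₁ + r₂ + 2)` elements. -/
theorem le_card_of_tjoins_far [NeZero L] {y₁ y₂ : Site d L} {r₁ r₂ : ℕ} {E₁ E₂ : Finset (Edge d L)}
    (hE₁ : ∀ e ∈ E₁, tsd y₁ e.1 ≤ r₁) (hE₂ : ∀ e ∈ E₂, tsd y₂ e.1 ≤ r₂) {Q : Finset (Plaquette d L)}
    (hJ : TJoins Q E₁ E₂) : tsd y₁ y₂ - (r₁ + r₂ + 2) ≤ Q.card := by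
  have h := le_card_of_tjoins (fun q : Plaquette d L => tsd y₁ q.1)
    (fun u v huv => tsd_le_tsd_add_one_of_padj y₁ huv) (a := r₁ + 1) (b := tsd y₁ y₂ - (r₂ + 1))
    (fun p hp => tsd_le_of_touch hE₁ hp) (fun q hq => le_tsd_of_touch hE₂ hq) hJ
  omega

/-- **The diagonal mirror image is far**: `tsd y (θy) = cyc (y_i - y_j)` (`i ≠ j`). -/
theorem tsd_siteDiagSwap [NeZero L] {i j : Fin d} (hij : i ≠ j) (y : Site d L) :
    tsd y (siteDiagSwap i j y) = cyc (lay i j y) := by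
  refine le_antisymm (tsd_le_of_forall fun k => ?_) ?_
  · by_cases hki : k = i
    · subst hki
      rw [siteDiagSwap, Equiv.swap_apply_left, lay, ← cyc_neg, neg_sub]
    · by_cases hkj : k = j
      · subst hkj
        rw [siteDiagSwap, Equiv.swap_apply_right, lay]
      · rw [siteDiagSwap, Equiv.swap_apply_of_ne_of_ne hki hkj, sub_self, cyc_zero]
        exact Nat.zero_le _
  · have h := cyc_apply_le_tsd y (siteDiagSwap i j y) j
    rwa [siteDiagSwap, Equiv.swap_apply_right] at h

end Geometry

/-! ## Uniform decay of far rest correlations -/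

section Far

variable {d L : ℕ} [NeZero L] {N : ℕ} {G : Type*} [Group G] [TopologicalSpace G]
  [IsTopologicalGroup G] [CompactSpace G] [MeasurableSpace G] [BorelSpace G]
  [SecondCountableTopology G] (ρ : G →* Matrix (Fin N) (Fin N) ℂ) (β : ℝ)

/-- ★★ **UNIFORM DECAY OF FAR REST CORRELATIONS.** Let `f`, `g` be bounded measurable real
observables reading disjoint link sets `E₁`, `E₂` based within `r₁` of `y₁`, resp. within `r₂` of
`y₂`, and `0 ≤ β ≤ r < betaOne d ρ`. Then for every set `V` of plaquettes switched on,
`|⟨fg⟩_V - ⟨f⟩_V⟨g⟩_V| ≤ 2 C_f C_g κ^{(#E₁ + #E₂) 2^d d²} (β/r)^{tsd y₁ y₂ - (r₁ + r₂ + 2)}`,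
`κ = 2e^{1/2}` — uniformly in `L` and in `V`. -/
theorem abs_restTrunc_le_of_far (hρ : Continuous ρ) (V : Finset (Plaquette d L))
    {f g : GaugeConfig d L G → ℝ} (hfm : Measurable f) (hgm : Measurable g) {Cf Cg : ℝ}
    (hfb : ∀ U, |f U| ≤ Cf) (hgb : ∀ U, |g U| ≤ Cg) {E₁ E₂ : Finset (Edge d L)}
    (hfE : DependsOn f (E₁ : Set (Edge d L))) (hgE : DependsOn g (E₂ : Set (Edge d L)))
    (hE : Disjoint E₁ E₂) {y₁ y₂ : Site d L} {r₁ r₂ : ℕ} (hE₁ : ∀ e ∈ E₁, tsd y₁ e.1 ≤ r₁)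
    (hE₂ : ∀ e ∈ E₂, tsd y₂ e.1 ≤ r₂) {r : ℝ} (hr : 0 < r) (hrR : r < betaOne d ρ)
    (hβ0 : 0 ≤ β) (hβr : β ≤ r) :
    |restTrunc ρ β V f g| ≤
      2 * Cf * Cg * (2 * Real.exp (1 / 2)) ^ ((E₁.card + E₂.card) * (2 ^ d * (d * d))) *
        (β / r) ^ (tsd y₁ y₂ - (r₁ + r₂ + 2)) :=
  abs_restTrunc_le ρ β hρ V hfm hgm hfb hgb hfE hgE hE
    (fun _ _ hJ => le_card_of_tjoins_far hE₁ hE₂ hJ) hr hrR hβ0 hβr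

end Far

end DiagRPUnif

end

end Summit.QuantumFields.GaugeBoot
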